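import Literature.MathematicalPhysics.QuantumFieldTheory.Balaban1983to89.B6LapLegKLevelV1L0
import Literature.MathematicalPhysics.QuantumFieldTheory.Balaban1983to89.B6GDVaLegKLevelV1
import Literature.MathematicalPhysics.QuantumFieldTheory.Balaban1983to89.B6OpTransposeV1L0
import Literature.MathematicalPhysics.QuantumFieldTheory.Balaban1983to89.B6CubeRightLegsV1L0
import Literature.MathematicalPhysics.QuantumFieldTheory.Balaban1983to89.B6Cover236MultiLevelBlocksL0
import Literature.MathematicalPhysics.QuantumFieldTheory.Balaban1983to89.B6CubeInDecayV1L0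
import Literature.MathematicalPhysics.QuantumFieldTheory.Balaban1983to89.B6CubeWindowV1L0
import Literature.MathematicalPhysics.QuantumFieldTheory.Balaban1983to89.B6Eq292MemberTorusV1L0
import Literature.MathematicalPhysics.QuantumFieldTheory.Balaban1983to89.B6Geom246MultiLevelBoxL0
import Literature.MathematicalPhysics.QuantumFieldTheory.Balaban1983to89.B6Geom246MultiLevelTorusL0
import Literature.MathematicalPhysics.QuantumFieldTheory.Balaban1983to89.B6GlobalChartV1L0
import Literature.MathematicalPhysics.QuantumFieldTheory.Balaban1983to89.B6GradLegKLevelV1L0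
import Literature.MathematicalPhysics.QuantumFieldTheory.Balaban1983to89.B6MultiLevelTorusOperatorL0
import Literature.MathematicalPhysics.QuantumFieldTheory.Balaban1983to89.B6Prop26KLevelSkeletonV1L0
import Literature.MathematicalPhysics.QuantumFieldTheory.Balaban1983to89.B8Ineq192MultiLevelTorusL0
/-!
# `Balaban1983to89.B6GDVaLegKLevelV1L0` — LEVEL-0 TWIN (programme G-F3′-L0, director-ym LINE №27 / UV3-NODE §24.5; plan `lit-balaban-r03/G-F3L0-PLAN.md`) of `B6GDVaLegKLevelV1`:
the same declarations, SAME NAMES AND STATEMENTS, for nested families WITH print's region `Λ₀ = T ∖ Ω₁` ADMITTED (structures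
`B6MultiLevelBoxOperatorL0.Domains` / `B6MultiLevelTorusOperatorL0.TDomains`: levels `0, …, k`, the level-`0` block a single site, `Q′₀ = id`,
finite weight `a₀` — print p.225 (2.14) «Σ_{j=0}^k … (Q′₀λ)(x) = λ(x), x ∈ Λ₀», p.229 «taking a sequence (2.1) … smallest possible domains B^j(Λ_j),
and considering the operator Δ_a defined by (2.19), (2.20) for this sequence»).  Every `D`-free object is the lineage's, consumed BY NAME; no existing
module is touched; no fact is minted.  Unit `lit-balaban-p33` (p33 gen 101; programme RIGHT-ENTRY-L0 = the (2.136)₃ right-factor chain at level 0, the input of [B9] Thm 3.3's right entry (3.42)₃ for the bond-sector cube letter G_□(1), cell GAPS G-B9-02; port tooling by r03 gen 36–37); B6 fold owner r03; referee ref-4.  THE TWIN'S DOCUMENTATION FOLLOWS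
VERBATIM (its «levels 1 … k» / «Ω₁ = X» sentences describe the twin; here `j` runs from `0` and `Ω₁` may be a proper subset).

# `Balaban1983to89.B6GDVaLegKLevelV1` — T. Bałaban, *Propagators and renormalization transformations for lattice gauge theories. II*,
# Commun. Math. Phys. **96** (1984) 223–250 [Balaban1984PropagatorsII], Prop. 2.6 (2.136) p. 247, the entry `|(G∇*J)(x)|`:
# THE FIRST LEG `h_□G_□h_□·∇^{η*}_ν` OF THE TRANSPOSED WALK, PER CUBE, FOR THE GENUINE MEMBER — by TRANSPOSING gen-30's `∇_ν·(h_□G_□h_□)`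

statement-level skeleton of published theorems with citation tags; proofs where landed; nothing here is a claim about the Yang–Mills mass gap

PDF held: `paper:balaban1984-cmp96-propagators-rt-ii` (journal page = PDF page + 222); p. 247 [PDF 25] ((2.133), (2.136), (2.141)) re-read this generation on the ×2
render `b2b-balaban-ref1/pages/1984-cmp96-propagators-rt-II/1984-cmp96-propagators-rt-II-p025-x2.png`.

CITATION HEADER (lean-in-tree rule) — WHAT IS REPRODUCED.  Phase-2 file of the `lit-balaban` typed skeleton (HOME `run/shared/lean/pub/lit-balaban/`), seat
**p38 gen 31** (TAKING line 2026-08-23, on p22 g23's invitation), brick 8 of the programme «(2.136)₃ by the transposed walk»; SKELETON rows B6.Prop2.6 ×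
B6.Eq2.133 × B6.Eq2.141 (cells; decls of record untouched).  Print (2.141) p. 247 expands `G = Σ_ω h_{□₀}G_{□₀}h_{□₀}K_{□₁□₂}G_{□₂}h_{□₂}…`; read from the right
(`…B6Prop26RightChainGeneric`), the first leg of the entry `|(G∇*J)(x)|` is `h_□G_□h_□∇*`.  THIS FILE proves its majorant for the genuine member by
TRANSPOSING gen-30's `B6GradLegKLevelV1L0.DV_sandwich_eq`/`hDG0_cube` with the transpose calculus `B6OpTransposeV1.tr`:
* §1 **`tr_shB`** (`(S_ν)ᵀ = S_ν⁻¹`), **`tr_DV`** (`(∇^η_ν)ᵀ = ∇^{η*}_ν`, i.e. `tr (DV ν c′) = DVa ν c′`);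
* §2 **`GDVa_sandwich_eq`** — `(h_□G_□h_□)∇*_ν = (c′/L^{j₀})•(h_□·(G_□E_{(ν,−)})·(S_νh_□)·) + h_□·G_□·(∇_νh_□)·` (the transpose of `DV_sandwich_eq`:
  `G_□ᵀ = G_□`, `E_{(ν,+)}ᵀ = E_{(ν,−)}`, multiplications symmetric);
* §3 **`hasMajorant_sandwich_in_right`** — the sandwich `f·T·h` with the LARGE factor on the right (`|f| ≤ 1`, `|h| ≤ t`);
* §4 **`hGDVa0_cube`** — `HasMajorant (h_□G_□h_□∇*_ν) (1_{Q_□}(y)·C_D·(L^{j(y)}·|c′|⁻¹)·e^{−ρ_D d_T(y,y′)})`, one `(ρ_D, C_D)` for all cubes, tori, `c′`, `ν`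
  (`L ≥ 5`): print's `O(1)Lʲη e^{−δd}` for the first leg, from p22's right legs `hGEin_cube` (`G_□E_{(ν,−)}`, `B6CubeRightLegsV1`) and r03's `hGin_cube`,
  the sizes `|S_νh_□| ≤ 1`, `|∇_νh_□| ≤ |c′|·C1F/(8S/5)` and the scale bookkeeping `pref_scale_le`/`lip_scale_le` of gen 30 — the displayed first-leg
  hypothesis of `…B6Prop26DivLegKLevelV1.prop26_2136_div_kLevel_of_outLeg`.
All theorems, proved, 0 sorry, no new `def … : Prop`; standard axioms.

HONEST SCOPE / DIVERGENCES.  (1) The prefactor `L^{j(y)}·|c′|⁻¹` sits at the OUTPUT block (as in gen-30's `hDG0_cube`); the assembly consumes it after a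
level-gap transport (`…B6Prop26DivLegKLevelV1`).  (2) `L ≥ 5`, `M_h = Lᵃ ≥ 8`, `R ≥ 2L²`, `P′ ≥ 5`, cube placed, as in gen 30.  Nothing on d = 4 or the
continuum; NOT summit progress.  Unit `lit-balaban-p38` (gen 31), 2026-08-23.
-/

noncomputable section

open scoped BigOperators
open Finset Matrix

namespace Literature.MathematicalPhysics.QuantumFieldTheory.Balaban1983to89.B6GDVaLegKLevelV1L0

open LatticeFieldCalculus
open B6MultiLevelBoxOperator (N0 bigSide)
open B6MultiLevelTorusOperatorL0 (TDomains)
open B6Cover236MultiLevelBlocksL0 (cubes)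
open B6Geom246MultiLevelBoxL0 (bset)
open B6Geom246MultiLevelTorusL0 (geomT)
open B8Ineq192MultiLevelTorusL0 (geomT_len)
open B6RandomWalk (HasMajorant hasMajorant_mono hasMajorant_add BlockSupp)
open B6Prop26Gluing (mulOp mulOp_apply ind ind_nonneg ind_le_one ind_of_mem ind_of_not_mem blockSupp_mulOp mulOp_eq_zero_of_blockSupp)
open B6GlobalChartV1 (PV toBox)
open B6GlobalChartV1L0 (blkV1 domT)
open B6SectAOperatorsV1 (BondIdx)
open B6Partition118KLevelFineSizes (C1F C1F_nonneg)
open B6Partition118KLevelTorusCentral (one_le_of_four_le)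
open B6Prop26KLevelSkeletonV1L0 (hB hB_apply ST mem_ST pref pref_nonneg abs_hB_le_one blkV1_mem_QT_of_hB_ne_zero)
open B6InMajorantTransplant (InMajorant)
open B6CubeWindowV1 (Placed one_le_of_eight_le four_le_of_five_le)
open B6CubeWindowV1L0 (j0 Gl)
open B6Eq292MemberTorusV1L0 (EC)
open B6CubeInDecayV1L0 (hGin_cube)
open B6CubeRightLegsV1L0 (hGEin_cube)
open B6Prop26LeftEntryKLevelV1 (hasMajorant_sandwich_in)
open B6Prop26KLevelAssemblyV1 (hasMajorant_smul)
open B6GradLegKLevelV1 (shB shB_apply DV DV_apply abs_DV_apply)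
open B6GradLegKLevelV1L0 (DV_sandwich_eq blkV1_mem_ST_of_hB_shift_ne_zero abs_hB_shift_sub_le pref_scale_le lip_scale_le)
open B6LapLegKLevelV1 (shBi shBi_apply DVa)
open B6OpTransposeV1 (tr dot_tr tr_unique tr_mul tr_add tr_sub tr_smul tr_one tr_mulOp tr_injective)
open B6OpTransposeV1L0 (tr_Gl tr_EC)
open B6GDVaLegKLevelV1 (tr_shB tr_DV hasMajorant_sandwich_in_right)
open B10StarCount (shift_unshift unshift_shift)

-- (§1 of the original — `tr_shB`, `tr_DV`: `(∇_ν)ᵀ = ∇*_ν` — is `D`-free and opened BY NAME)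

/-! ## §2  The operator identity: the transpose of `DV_sandwich_eq` -/

section Cube

variable {d ℓ : ℕ} {hd : 1 ≤ d + 1} {hL : Odd (ℓ + 1) ∧ 1 < ℓ + 1} {a₀ a₁ : ℝ} {m K : ℕ} {Mh k R : ℕ} {P' : Fin (d + 1) → ℕ}
variable (hN : ∀ μ, N0 ℓ Mh k P' μ = (PV d ℓ m K hd hL).sitesPerDir 0) {D : TDomains d ℓ Mh k P' R} (hk : k ≤ m + K)
  (hMh1 : 1 ≤ Mh) (hP4 : ∀ μ, 4 ≤ P' μ) {a : ℕ} (hMha : Mh = (ℓ + 1) ^ a) (c : ↥(cubes D.toDomains)) (ha : a₀ ≤ a₁)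

/-- **`(h_□G_□h_□)·∇*_ν = (c′/L^{j₀})•(h_□·G_□E_{(ν,−)}·(S_νh_□)·) + h_□·G_□·(∇_νh_□)·`** — the transpose of gen-30's `DV_sandwich_eq` (`a₀ > 0`).
[cite: Balaban1984PropagatorsII, (2.141) p.247 (first leg), (2.92) p.239 (line 1), (2.94) p.239] -/
theorem GDVa_sandwich_eq (ha₀ : 0 < a₀) (hM8 : 8 ≤ Mh) (hR2 : 2 * (ℓ + 1) ^ 2 ≤ R) (hpl : Placed ℓ k P' c.1) (w : BondIdx (B6GlobalChartV1L0.domT hN D hk) → ℝ)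
    {cf : ℝ} (hcf : cf ≠ 0) (ν : Fin (d + 1)) :
    mulOp (hB hN D c) * Gl hN hk hMh1 hP4 hMha c ha hpl w cf * mulOp (hB hN D c) * DVa ν cf =
      (cf / (((ℓ + 1 : ℕ) : ℝ)) ^ j0 hMh1 hP4 c) •
          (mulOp (hB hN D c) * (Gl hN hk hMh1 hP4 hMha c ha hpl w cf * EC hN hk hMh1 hP4 hMha c ha hpl w cf (ν, false)) *
            mulOp (shB ν (hB hN D c))) +
        mulOp (hB hN D c) * Gl hN hk hMh1 hP4 hMha c ha hpl w cf * mulOp (DV ν cf (hB hN D c)) := by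
  have h := congrArg tr (DV_sandwich_eq hN hk hMh1 hP4 hMha c ha hM8 hR2 hpl w hcf ν)
  simp only [tr_mul, tr_add, tr_smul, tr_mulOp, tr_Gl hN hk hMh1 hP4 hMha c ha ha₀, tr_EC, tr_DV, Bool.not_true, ← mul_assoc] at h
  rw [h]
  simp only [← mul_assoc]

end Cube

-- (§3 of the original — `hasMajorant_sandwich_in_right` — is `D`-free and opened BY NAME)

/-! ## §4  The first leg `h_□G_□h_□∇*_ν` of the transposed walk -/

-- LEVEL-0 JOINT J8 (r03 PLAN §11; pattern of `B6GradLegKLevelV1L0.hDG0_cube`): the fine-step size `abs_hB_shift_sub_le` of the level-0 twin needs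
-- `2L ≤ M_h`, so `hGDVa0_cube` carries the extra binder `(_ : 2 * (ℓ + 1) ≤ Mh)` after `(_ : 8 ≤ Mh)`; consumers derive it from the threshold `max … (2L²) ≤ L·M_h`.

section Leg

variable {d ℓ : ℕ} {hd : 1 ≤ d + 1} {hL : Odd (ℓ + 1) ∧ 1 < ℓ + 1} {m K : ℕ} {Mh k R : ℕ} {P' : Fin (d + 1) → ℕ}

open Classical in
/-- **THE FIRST LEG OF THE TRANSPOSED WALK FOR THE ENTRY `|(G∇*J)(x)|`, PER CUBE, FOR THE GENUINE MEMBER** (`L ≥ 5`): there are `ρ_D > 0`, `C_D ≥ 0` (on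
`d, L` and the weight band `[a₀, a₁]` only) such that on every admissible V1 torus (`M_h = Lᵃ ≥ 8`, `R ≥ 2L²`, `P′ ≥ 5`, cube placed), for every `c′ ≠ 0`,
weights `w`, direction `ν` and cube `□`:
`HasMajorant (geomT D) (blkV1 hN D) ((h_□G_□h_□)·∇*_ν) (1_{Q_□}(y)·C_D·(L^{j(y)}·|c′|⁻¹)·e^{−ρ_D d_T(y,y′)})` — print's `O(1)·Lʲη·e^{−δd}` for the first leg.
[cite: Balaban1984PropagatorsII, Prop. 2.6 (2.136) p.247 («|(G∇*J)(x)| ≤ O(1)Lʲη…»), (2.141) p.247, (2.133) p.247, (2.92) p.239 line 1] -/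
theorem hGDVa0_cube (d ℓ : ℕ) (hd : 1 ≤ d + 1) (hL : Odd (ℓ + 1) ∧ 1 < ℓ + 1) {a₀ a₁ : ℝ} (ha₀ : 0 < a₀) (ha₁ : a₀ ≤ a₁) :
    ∃ ρD : ℝ, 0 < ρD ∧ ∃ CD : ℝ, 0 ≤ CD ∧ ∀ (m K : ℕ) {Mh k R : ℕ} {P' : Fin (d + 1) → ℕ}
      (hN : ∀ μ, N0 ℓ Mh k P' μ = (PV d ℓ m K hd hL).sitesPerDir 0) (D : TDomains d ℓ Mh k P' R) (hk : k ≤ m + K)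
      (hMh1 : 1 ≤ Mh) (hP4 : ∀ μ, 4 ≤ P' μ) {a : ℕ} (hMha : Mh = (ℓ + 1) ^ a) (_ : 8 ≤ Mh) (_ : 2 * (ℓ + 1) ≤ Mh) (_ : 2 * (ℓ + 1) ^ 2 ≤ R)
      (_ : ∀ μ, 5 ≤ P' μ) (_ : 4 ≤ ℓ) (c : ↥(cubes D.toDomains)) (hpl : Placed ℓ k P' c.1) (w : BondIdx (B6GlobalChartV1L0.domT hN D hk) → ℝ) {cf : ℝ} (_ : cf ≠ 0) (ν : Fin (d + 1)),
      HasMajorant (g := geomT D) (blkV1 hN D)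
        (mulOp (hB hN D c) * Gl hN hk hMh1 hP4 hMha c ha₁ hpl w cf * mulOp (hB hN D c) * DVa ν cf)
        (fun y y' => ind (ST D hMh1 hP4 c) y * (CD * ((geomT D).len y * |cf|⁻¹) * Real.exp (-(ρD * (geomT D).dist y y')))) := by
  obtain ⟨ρG, hρG, CG, hCG, hGin⟩ := hGin_cube d ℓ hd hL ha₀ ha₁
  obtain ⟨ρE, hρE, CE, hCE, hGEin⟩ := hGEin_cube d ℓ hd hL ha₀ ha₁
  refine ⟨min ρG ρE, lt_min hρG hρE, (((ℓ + 1 : ℕ) : ℝ)) ^ 2 * CE + (((ℓ + 1 : ℕ) : ℝ)) ^ 2 * C1F d ℓ * CG, by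
    have := C1F_nonneg d ℓ; positivity, ?_⟩
  intro m K Mh k R P' hN D hk hMh1 hP4 a hMha hM8 hMhL hR2 hP5 hℓ c hpl w cf hcf ν
  have hMh : 2 ≤ Mh := le_trans (by norm_num) hM8
  have hR : 2 * (ℓ + 1) ≤ R := le_trans (by nlinarith : 2 * (ℓ + 1) ≤ 2 * (ℓ + 1) ^ 2) hR2
  have hP : ∀ μ, 1 ≤ P' μ := one_le_of_four_le hP4
  have hdnn : ∀ y y' : (geomT D).Site, 0 ≤ (geomT D).dist y y' := fun _ _ => Nat.cast_nonneg _
  have hC1 := C1F_nonneg d ℓ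
  -- the two input-localised legs of the member
  have hE := hGEin m K hN D hk hMh1 hP4 hMha hMh hR2 hℓ c hpl w cf (ν, false)
  have hG := hGin m K hN D hk hMh1 hP4 hMha hMh hR2 hℓ c hpl w cf
  -- term 1: `h_□·(G_□E_{(ν,−)})·(S_νh_□)`
  have hT1 := hasMajorant_sandwich_in (g := geomT D) (blkV1 hN D) (S := ST D hMh1 hP4 c) (s := 1)
    (f := hB hN D c) (h := shB ν (hB hN D c))
    (K := fun y y' => CE * pref cf y * Real.exp (-(ρE * (geomT D).dist y y')))
    (fun y y' => by have := pref_nonneg cf y; positivity) zero_le_one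
    (fun b hb => (mem_ST D hMh1 hP4 c _).2 (blkV1_mem_QT_of_hB_ne_zero hN D hMh hR hP4 c hb))
    (fun b => abs_hB_le_one hN D hMh1 hP c b)
    (fun b hb => blkV1_mem_ST_of_hB_shift_ne_zero hN hMh1 hP4 c hM8 hR hP5 ν (by simpa [shB_apply] using hb))
    (fun b => by rw [shB_apply]; exact abs_hB_le_one hN D hMh1 hP c _) hE
  -- term 2: `h_□·G_□·(∇_νh_□)`
  have hT2 := hasMajorant_sandwich_in_right (g := geomT D) (blkV1 hN D) (S := ST D hMh1 hP4 c)
    (t := |cf| * (C1F d ℓ / (8 / 5 * (bigSide ℓ Mh c.1.1 : ℝ))))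
    (f := hB hN D c) (h := DV ν cf (hB hN D c))
    (K := fun y y' => CG * pref cf y * Real.exp (-(ρG * (geomT D).dist y y')))
    (fun y y' => by have := pref_nonneg cf y; positivity) (by positivity)
    (fun b hb => (mem_ST D hMh1 hP4 c _).2 (blkV1_mem_QT_of_hB_ne_zero hN D hMh hR hP4 c hb))
    (fun b => abs_hB_le_one hN D hMh1 hP c b)
    (fun b hb => by
      by_cases h1 : hB hN D c ⟨b.src.shift ν, b.dir⟩ ≠ 0
      · exact blkV1_mem_ST_of_hB_shift_ne_zero hN hMh1 hP4 c hM8 hR hP5 ν h1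
      · have h2 : hB hN D c b ≠ 0 := by
          intro h0; apply hb; rw [DV_apply, not_not.1 h1, h0]; ring
        exact (mem_ST D hMh1 hP4 c _).2 (blkV1_mem_QT_of_hB_ne_zero hN D hMh hR hP4 c h2))
    (fun b => by rw [abs_DV_apply]; exact mul_le_mul_of_nonneg_left (abs_hB_shift_sub_le hN c hMhL hR hP5 ν b) (abs_nonneg _)) hG
  -- the operator identity and the sum of the two majorants
  rw [GDVa_sandwich_eq hN hk hMh1 hP4 hMha c ha₁ ha₀ hM8 hR2 hpl w hcf ν]
  have hT1' := hasMajorant_smul (g := geomT D) (blkV1 hN D) hT1 (cf / (((ℓ + 1 : ℕ) : ℝ)) ^ j0 hMh1 hP4 c)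
  refine hasMajorant_mono _ (hasMajorant_add _ hT1' hT2) fun y y' => ?_
  -- pointwise comparison of the kernels
  have habs : |cf / (((ℓ + 1 : ℕ) : ℝ)) ^ j0 hMh1 hP4 c| = |cf| / (((ℓ + 1 : ℕ) : ℝ)) ^ j0 hMh1 hP4 c := by
    rw [abs_div, abs_of_pos (by positivity : (0 : ℝ) < (((ℓ + 1 : ℕ) : ℝ)) ^ j0 hMh1 hP4 c)]
  rw [habs]
  by_cases hy : y ∈ ST D hMh1 hP4 c
  · have hi : ind (ST D hMh1 hP4 c) y = 1 := ind_of_mem hy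
    rw [hi]
    have hlen : 0 ≤ (geomT D).len y * |cf|⁻¹ := by rw [geomT_len]; positivity
    have e1 : Real.exp (-(ρE * (geomT D).dist y y')) ≤ Real.exp (-(min ρG ρE * (geomT D).dist y y')) :=
      Real.exp_le_exp.mpr (neg_le_neg (mul_le_mul_of_nonneg_right (min_le_right _ _) (hdnn y y')))
    have e2 : Real.exp (-(ρG * (geomT D).dist y y')) ≤ Real.exp (-(min ρG ρE * (geomT D).dist y y')) :=
      Real.exp_le_exp.mpr (neg_le_neg (mul_le_mul_of_nonneg_right (min_le_left _ _) (hdnn y y')))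
    have hps := pref_scale_le hL hMh1 hP4 c hR2 hcf hy
    have hls := lip_scale_le hL hMh1 hP4 c hR2 hcf hy
    have hpref := pref_nonneg cf y
    calc |cf| / (((ℓ + 1 : ℕ) : ℝ)) ^ j0 hMh1 hP4 c * (1 * ind (ST D hMh1 hP4 c) y' * (1 * (CE * pref cf y * Real.exp (-(ρE * (geomT D).dist y y'))))) +
          1 * ind (ST D hMh1 hP4 c) y' * (|cf| * (C1F d ℓ / (8 / 5 * (bigSide ℓ Mh c.1.1 : ℝ))) *
            (CG * pref cf y * Real.exp (-(ρG * (geomT D).dist y y'))))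
        ≤ |cf| / (((ℓ + 1 : ℕ) : ℝ)) ^ j0 hMh1 hP4 c * (1 * 1 * (1 * (CE * pref cf y * Real.exp (-(min ρG ρE * (geomT D).dist y y'))))) +
          1 * 1 * (|cf| * (C1F d ℓ / (8 / 5 * (bigSide ℓ Mh c.1.1 : ℝ))) *
            (CG * pref cf y * Real.exp (-(min ρG ρE * (geomT D).dist y y')))) := by
          gcongr
          · exact ind_le_one _ _
          · exact ind_le_one _ _
      _ = CE * (|cf| / (((ℓ + 1 : ℕ) : ℝ)) ^ j0 hMh1 hP4 c * pref cf y) * Real.exp (-(min ρG ρE * (geomT D).dist y y')) +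
          CG * (|cf| * (C1F d ℓ / (8 / 5 * (bigSide ℓ Mh c.1.1 : ℝ))) * pref cf y) * Real.exp (-(min ρG ρE * (geomT D).dist y y')) := by ring
      _ ≤ CE * ((((ℓ + 1 : ℕ) : ℝ)) ^ 2 * ((geomT D).len y * |cf|⁻¹)) * Real.exp (-(min ρG ρE * (geomT D).dist y y')) +
          CG * ((((ℓ + 1 : ℕ) : ℝ)) ^ 2 * C1F d ℓ * ((geomT D).len y * |cf|⁻¹)) * Real.exp (-(min ρG ρE * (geomT D).dist y y')) := by
          gcongr
      _ = 1 * (((((ℓ + 1 : ℕ) : ℝ)) ^ 2 * CE + (((ℓ + 1 : ℕ) : ℝ)) ^ 2 * C1F d ℓ * CG) * ((geomT D).len y * |cf|⁻¹) *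
          Real.exp (-(min ρG ρE * (geomT D).dist y y'))) := by ring
  · have hi : ind (ST D hMh1 hP4 c) y = 0 := ind_of_not_mem hy
    rw [hi]
    simp

end Leg

end Literature.MathematicalPhysics.QuantumFieldTheory.Balaban1983to89.B6GDVaLegKLevelV1L0
end
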